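import Summits.QuantumFields.BalabanUV.T4Continuum.Spine.NE3.LandauProjectionCurvedFix
import Mathlib.Algebra.Order.Chebyshev
import HarnessLib

/-!
# T⁴ programme, node NE3 — census R40 (file (ii)b): THE CURVED INVERSE INEQUALITIES FOR `h ⊥ N(Q′(W))` —
# `ℓ²` SMALLNESS OF `Δ_W g ⊥ N` AND THE `ℓ¹ → ℓ^∞` STEP, AT A CURVED BACKGROUND OF THE MULTI-LEVEL CLASS, BY THE NESTED-MEAN FIX

Cell `pub-balaban-gaps` (YM blitz, track G2, seat `ne3`, unit `pub-balaban-gaps-ne3-g9`; writer prover-pub-balaban-gaps-ne3-g9-0, 2026-08-24),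
census `run/shared/lean/pub/pub-balaban-gaps/ne/NE3.md` §4 R40.  WHY.  (HR_W) — the `ℓ^∞` bound of B8's (1.38)-projection onto `Δ_W N(Q′(W))` — is the
last analytic input of THE END's sup letter `hK` at a curved background (gen 8, `LandauCorrectionSupB8Cavg`).  R38's flat mechanism («`Δ_1 g` is
block-constant» + an inverse inequality against a bump) is replaced at a curved `W` by the nested-mean fix of the companion `LandauProjectionCurvedFix`
(`exists_fix`: for every skew periodic `φ` a skew periodic `ψ` with `φ − ψ ∈ N`, small energy, small sup):

* §1 **`sum_nhsNormSq_covLapSite_le_of_perp`** — THE `ℓ²` INVERSE INEQUALITY: for skew `P`-periodic `g` (`P = N·M`, `M = L^{j+1}`) with `Δ_W g ⊥ N` (in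
  `hsR`-sums over the period box), `Σ nhs(Δ_W g) ≤ β²·Σ nhs(g)`, `β = 18d·card n·(1∕M + 2(d−1)(M−1)x)²∕tentMean²` — i.e. `O(M^{−4})` —
  via `⟨h,h⟩ = ⟨h,ψ⟩ = Σ⟨D_Wg, D_Wψ⟩`, `Σ nhs(D_Wg) = ⟨h, g⟩`, and the fix's energy `Σ‖D_Wψ‖² ≤ β·Σ nhs(h)`.
* §2 **`norm_le_of_perp`** — THE `ℓ¹ → ℓ^∞` STEP: for skew `P`-periodic `h ⊥ N`, `‖h y‖ ≤ 3·card n·tentMean⁻¹·M^{−d}·Σ_{y′∈[0,P)^d}‖h y′‖`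
  (test `h` against the periodic delta at `y` minus its fix).

HONEST: lattice linear algebra at one background of the multi-level small-field class (`L ≥ 2`, `LevelSmall`, `SmallField W x`); 0 sorry; no `def`;
nothing of Bałaban's asserted; (HR_W) is ASSEMBLED in the companion `LandauProjectionSupCurved` (with `CovariantMeanValue`); `hK`∕(P♮) at curved `W`,
`PairLandauGaugeB8Avg`, the covariant root and **NE3 are NOT proved**; spine PROVED 0∕9; finite T⁴ rung (B)+1 — NOT infinite volume, NOT mass gap,
NOT `BetaPertH`, NOT Clay.  PLACEMENT: `Summits/QuantumFields/BalabanUV/T4Continuum/Spine/NE3/`; imports accepted modules only; moves nothing.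
HONEST DEPENDENCY (cell page 1): continuum YM on T⁴ ⇐ BetaPertH ∧ nine spine estimates (0/9 proved); BetaPertH ⇐ (D1) ∧ (D4) ∧ CAP+tail.
-/

set_option autoImplicit false

open scoped BigOperators Matrix Matrix.Norms.L2Operator
open NormedSpace Finset

namespace Summit.QuantumFields.BalabanUV.T4Continuum.NE3.LandauProjectionCurvedCore

open Literature.MathematicalPhysics.QuantumFieldTheory.Balaban1983to89
open B7Prop1Explicit B7Prop2Explicit MatrixNorms
open T4AveragingDeficitWall (Ad IsUnitaryCfg IsSkewDir SmallField)
open T4AveragingDeficitWallBoundary (IsPeriodicCfg periodBox mem_periodBox card_periodBox)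
open AveragingDeficitPeriodicCounting (IsPeriodicDir)
open AveragingDeficitMultiLevelPrep (LevelSmall tower)
open AveragingDeficitTorusChart (periodic_smul_vec)
open AveragingDeficitTransport (norm_Ad_of_unitary)
open AveragingDeficitBlockDensity (btree btree_mem)
open BlockAveragePushDirGauge (gaugeDir isPeriodicDir_gaugeDir)
open SmoothRefineBlocks (blk)
open SkeletonLattice (cdiv cmod smul_cdiv_add_cmod cmod_nonneg cmod_lt cmod_eq_of_repr cmod_add_period)
open SpreadLift (loopRad)
open AveragingDeficitTwoLevelPrep (prop1Radius)
open NE3CovariantCalculus (hsR hsR_self hsR_comm hsR_sub_right nhsNormSq_sub abs_hsR_le)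
open NE3CovariantSBound (abs_hsR_le_nhsNorm)
open NE3CovariantWeitzenbock (covDiv)
open NE3CovariantBlockMean (bmeanW bmeanIterW)
open NE3TentBump (bump tent tent_nonneg tent_le_one)
open NE3DressedBlockField (dressW)
open NE3NestedMeanBlockOperator (tentMean tentMean_pos inv_le_tentMean bmeanIterW_add_period' star_bmeanIterW dressW_bump_block)
open NE3NestedBlockMeanCovariance (norm_bmeanW_le_mean)
open NE3NestedBlockMeanBridge (norm_bmeanIterW_sub_bmeanW_le)
open NE3TopRadiusLetters (E_le_half_of_levelSmall)
open NE3BlockLineAverage (sum_univ_boxVec sum_periodBox_blocks)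
open NE3FrameFreeSliceW (bmeanIterW_add bmeanIterW_zero' bmeanIterW_smul)
open NE3SlicePoincareCompetitorEnergy (bmeanIterW_sub')
open NE3CompetitorNestedFix (nfixCoef norm_nfixCoef_le nfixW bmeanIterW_nfixW nfixW_mem_skewAdjoint nfixW_add_period sum_normSq_gaugeDir_nfixW_le)
open NE3LandauOrbit (sum_hsR_gaugeDir gaugeDir_skew hsR_zero_right)
open NE3CurvedCornerGaugeSpace (covDiv_mem_skewAdjoint)
open NE3CurvedProjectedLandau (tower_eq_pow_mul)
open NE3CovariantLineSumsError (iterate_prop1Radius_nonneg)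
open NE3.PairLandauB8 (avgKernelGauges covLapSite mem_avgKernelGauges_iff)
open NE3.LandauProjectionB8 (covDiv_gaugeDir_eq_covLapSite covLapSite_add_period sum_nhsNormSq_gaugeDir_eq)

open NE3.LandauProjectionCurvedFix (norm_bmeanIterW_le sum_normSq_bmeanIterW_le exists_fix sum_block_delta_le)

noncomputable section

variable {d : ℕ} {n : Type*} [Fintype n] [DecidableEq n]

/-! ## §1 The `ℓ²` inverse inequality for `Δ_W g ⊥ N(Q′(W))` -/

section Perp

variable [Nonempty n] {L N : ℕ} (hL : 2 ≤ L) (hN : 1 ≤ N) (j : ℕ) {W : Site d → Fin d → (Matrix n n ℂ)ˣ} {x : ℝ}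
  (hWu : IsUnitaryCfg W) (hWP : IsPeriodicCfg W ((N * L ^ (j + 1) : ℕ) : ℤ)) (hx : 0 ≤ x) (hsm : LevelSmall d L j x) (hWx : SmallField W x)

include hL hN hWu hWP hx hsm hWx in
/-- **THE `ℓ²` INVERSE INEQUALITY FOR `Δ_W g ⊥ N(Q′(W))`** (`L ≥ 2`, `N ≥ 1`, multi-level class at `W`, period `P = N·M`, `M = L^{j+1}`): for skew
`P`-periodic `g` whose covariant Laplacian `h = Δ_W g` is `hsR`-orthogonal over the period box to `N(Q′(W)) = avgKernelGauges L N (j+1) W`: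
`Σ_{y∈[0,P)^d} nhs(Δ_W g y) ≤ β²·Σ_y nhs(g y)`, `β = 18d·card n·(1∕M + 2(d−1)(M−1)x)²∕tentMean(d,M)²` (so `β = O(d·card n·8^{2d}(1 + 2(d−1)M²x)²∕M²)`).
MECHANISM: `ψ := nfixW 0 (Q′h)`; `Σ nhs h = ⟨h,ψ⟩ = ΣΣ hsR (D_Wg)(D_Wψ)` (`nfix_perp_identity`, `sum_hsR_gaugeDir`); Cauchy–Schwarz twice with
`Σ nhs(D_Wg) = ⟨h, g⟩` (`sum_nhsNormSq_gaugeDir_eq`) and the fix's energy `Σ‖D_Wψ‖² ≤ 2dM^d(1∕M + 2(d−1)(M−1)x)²(2∕tentMean)²Σ_z‖Q′h z‖² ≤ β·Σ nhs h`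
(`sum_normSq_gaugeDir_nfixW_le`, §1). [folklore] -/
theorem sum_nhsNormSq_covLapSite_le_of_perp {g : Site d → Matrix n n ℂ} (hgs : ∀ y, g y ∈ skewAdjoint (Matrix n n ℂ))
    (hgP : ∀ (y : Site d) (i : Fin d), g (y + ((N * L ^ (j + 1) : ℕ) : ℤ) • e i) = g y)
    (hperp : ∀ ν ∈ avgKernelGauges (d := d) (n := n) L N (j + 1) W,
      ∑ y ∈ periodBox (d := d) (N * L ^ (j + 1)), hsR (covLapSite W g y) (ν y) = 0) :
    ∑ y ∈ periodBox (d := d) (N * L ^ (j + 1)), nhsNormSq (covLapSite W g y)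
      ≤ (18 * (d : ℝ) * Fintype.card n
            * (1 / (((L ^ (j + 1) : ℕ) : ℝ)) + 2 * (((d : ℝ) - 1) * ((((L ^ (j + 1) : ℕ) : ℝ)) - 1) * x)) ^ 2
            / tentMean d (L ^ (j + 1)) ^ 2) ^ 2
        * ∑ y ∈ periodBox (d := d) (N * L ^ (j + 1)), nhsNormSq (g y) := by
  classical
  have hL1 : 1 ≤ L := by omega
  -- the objects: `h = Δ_W g` (skew, periodic) and its fix `ψ`
  have hhs : ∀ y, covLapSite W g y ∈ skewAdjoint (Matrix n n ℂ) := fun y => by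
    rw [← covDiv_gaugeDir_eq_covLapSite]; exact covDiv_mem_skewAdjoint hWu (gaugeDir_skew hWu hgs) y
  have hhP : ∀ (y : Site d) (i : Fin d), covLapSite W g (y + ((N * L ^ (j + 1) : ℕ) : ℤ) • e i) = covLapSite W g y :=
    fun y i => covLapSite_add_period hWP hgP y i
  obtain ⟨ψ, -, hψP, hmem, hψE, -⟩ := exists_fix hL j hWu hWP hx hsm hWx hhs hhP
  have hident : ∑ y ∈ periodBox (d := d) (N * L ^ (j + 1)), nhsNormSq (covLapSite W g y)
      = ∑ y ∈ periodBox (d := d) (N * L ^ (j + 1)), hsR (covLapSite W g y) (ψ y) := by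
    have h0 := hperp _ hmem
    simp only [hsR_sub_right, Finset.sum_sub_distrib, sub_eq_zero] at h0
    simp_rw [← hsR_self]
    exact h0
  have hPMN' : L ^ (j + 1) * N = N * L ^ (j + 1) := Nat.mul_comm _ _
  rw [hPMN'] at hψE
  set h : Site d → Matrix n n ℂ := covLapSite W g with hh
  set M : ℕ := L ^ (j + 1) with hMdef
  have hM2 : 2 ≤ M := le_trans hL (Nat.le_self_pow (by omega) L)
  have hM1 : 1 ≤ M := by omega
  set P : ℕ := N * M with hPdef
  have hP : 1 ≤ P := Nat.mul_pos (by omega) (by omega)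
  set cn : ℝ := (Fintype.card n : ℝ) with hcn
  have hcn0 : 0 ≤ cn := by positivity
  set tm : ℝ := tentMean d M with htm
  have htm0 : 0 < tm := tentMean_pos hM2 d
  set κ : ℝ := 1 / (((M : ℕ) : ℝ)) + 2 * (((d : ℝ) - 1) * ((((M : ℕ) : ℝ)) - 1) * x) with hκ
  set β : ℝ := 18 * (d : ℝ) * cn * κ ^ 2 / tm ^ 2 with hβ
  have hβ0 : 0 ≤ β := by positivity
  -- the energies
  set A : ℝ := ∑ y ∈ periodBox (d := d) P, nhsNormSq (h y) with hA
  set Gn : ℝ := ∑ y ∈ periodBox (d := d) P, nhsNormSq (g y) with hGn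
  set Eg : ℝ := ∑ y ∈ periodBox (d := d) P, ∑ μ : Fin d, nhsNormSq (gaugeDir W g y μ) with hEg
  set Eψ : ℝ := ∑ y ∈ periodBox (d := d) P, ∑ μ : Fin d, ‖gaugeDir W ψ y μ‖ ^ 2 with hEψ
  have hA0 : 0 ≤ A := Finset.sum_nonneg fun y _ => nhsNormSq_nonneg _
  have hGn0 : 0 ≤ Gn := Finset.sum_nonneg fun y _ => nhsNormSq_nonneg _
  have hEg0 : 0 ≤ Eg := Finset.sum_nonneg fun y _ => Finset.sum_nonneg fun μ _ => nhsNormSq_nonneg _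
  -- (1) `A = ⟨h, ψ⟩ = ΣΣ hsR (D g)(D ψ)`, so `A² ≤ Eg · Eψ`
  have hpair : A = ∑ y ∈ periodBox (d := d) P, ∑ μ : Fin d, hsR (gaugeDir W g y μ) (gaugeDir W ψ y μ) := by
    rw [hident, sum_hsR_gaugeDir hP hWu (isPeriodicDir_gaugeDir hWP hgP) hψP, covDiv_gaugeDir_eq_covLapSite]
  have hA2 : A ^ 2 ≤ Eg * Eψ := by
    have h1 : A ≤ ∑ q ∈ periodBox (d := d) P ×ˢ (Finset.univ : Finset (Fin d)), nhsNorm (gaugeDir W g q.1 q.2) * nhsNorm (gaugeDir W ψ q.1 q.2) := by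
      rw [hpair, ← Finset.sum_product']
      exact Finset.sum_le_sum fun q _ => (le_abs_self _).trans (abs_hsR_le_nhsNorm _ _)
    have h2 := Finset.sum_mul_sq_le_sq_mul_sq (periodBox (d := d) P ×ˢ (Finset.univ : Finset (Fin d)))
      (fun q => nhsNorm (gaugeDir W g q.1 q.2)) (fun q => nhsNorm (gaugeDir W ψ q.1 q.2))
    have h3 : ∑ q ∈ periodBox (d := d) P ×ˢ (Finset.univ : Finset (Fin d)), nhsNorm (gaugeDir W g q.1 q.2) ^ 2 = Eg := by
      rw [hEg, ← Finset.sum_product']; simp only [nhsNorm_sq]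
    have h4 : ∑ q ∈ periodBox (d := d) P ×ˢ (Finset.univ : Finset (Fin d)), nhsNorm (gaugeDir W ψ q.1 q.2) ^ 2 ≤ Eψ := by
      rw [hEψ, ← Finset.sum_product']
      exact Finset.sum_le_sum fun q _ => by rw [nhsNorm_sq]; exact nhsNormSq_le_opNorm_sq _
    calc A ^ 2 ≤ (∑ q ∈ periodBox (d := d) P ×ˢ (Finset.univ : Finset (Fin d)), nhsNorm (gaugeDir W g q.1 q.2) * nhsNorm (gaugeDir W ψ q.1 q.2)) ^ 2 :=
          pow_le_pow_left₀ hA0 h1 2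
      _ ≤ Eg * ∑ q ∈ periodBox (d := d) P ×ˢ (Finset.univ : Finset (Fin d)), nhsNorm (gaugeDir W ψ q.1 q.2) ^ 2 := by rw [← h3]; exact h2
      _ ≤ Eg * Eψ := mul_le_mul_of_nonneg_left h4 hEg0
  -- (2) `Eg = ⟨h, g⟩`, so `Eg² ≤ A · Gn`
  have hEg2 : Eg ^ 2 ≤ A * Gn := by
    have h1 : Eg = ∑ y ∈ periodBox (d := d) P, hsR (h y) (g y) := sum_nhsNormSq_gaugeDir_eq hP hWu hWP hgP
    have h2 : Eg ≤ ∑ y ∈ periodBox (d := d) P, nhsNorm (h y) * nhsNorm (g y) := by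
      rw [h1]; exact Finset.sum_le_sum fun y _ => (le_abs_self _).trans (abs_hsR_le_nhsNorm _ _)
    have h3 := Finset.sum_mul_sq_le_sq_mul_sq (periodBox (d := d) P) (fun y => nhsNorm (h y)) (fun y => nhsNorm (g y))
    simp only [nhsNorm_sq] at h3
    exact (pow_le_pow_left₀ hEg0 h2 2).trans h3
  -- (3) the energy of the fix: `Eψ ≤ β · A`
  have hEψ_le : Eψ ≤ β * A := by
    have h2 := sum_normSq_bmeanIterW_le hL j hWu hx hsm hWx h N
    rw [hPMN'] at h2
    have h3 : ∑ y ∈ periodBox (d := d) P, ‖h y‖ ^ 2 ≤ cn * A := by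
      rw [hA, Finset.mul_sum]; exact Finset.sum_le_sum fun y _ => opNorm_sq_le_card_mul_nhsNormSq (h y)
    have hMd : (0 : ℝ) < (((M : ℕ) : ℝ)) ^ d := by positivity
    have hK0 : 0 ≤ 2 * ((d : ℝ) * (((M : ℕ) : ℝ)) ^ d * κ ^ 2) * (2 / tm) ^ 2 := by positivity
    calc Eψ ≤ 2 * ((d : ℝ) * (((M : ℕ) : ℝ)) ^ d * κ ^ 2) * ((2 / tm) ^ 2 * ∑ z ∈ periodBox (d := d) N, ‖bmeanIterW L (j + 1) W h z‖ ^ 2) := hψE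
      _ = (2 * ((d : ℝ) * (((M : ℕ) : ℝ)) ^ d * κ ^ 2) * (2 / tm) ^ 2) * ∑ z ∈ periodBox (d := d) N, ‖bmeanIterW L (j + 1) W h z‖ ^ 2 := by ring
      _ ≤ (2 * ((d : ℝ) * (((M : ℕ) : ℝ)) ^ d * κ ^ 2) * (2 / tm) ^ 2) * (9 / 4 * (((((M : ℕ) : ℝ)) ^ d)⁻¹ * (cn * A))) := by
          refine mul_le_mul_of_nonneg_left (h2.trans ?_) hK0
          exact mul_le_mul_of_nonneg_left (mul_le_mul_of_nonneg_left h3 (by positivity)) (by norm_num)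
      _ = β * A := by rw [hβ]; field_simp; ring
  -- (4) close: `A² ≤ Eg·βA ⟹ A ≤ β·Eg ⟹ A² ≤ β²·A·Gn ⟹ A ≤ β²·Gn`
  have hstep1 : A ≤ β * Eg := by
    have hsq : A ^ 2 ≤ β * Eg * A :=
      calc A ^ 2 ≤ Eg * Eψ := hA2
        _ ≤ Eg * (β * A) := mul_le_mul_of_nonneg_left hEψ_le hEg0
        _ = β * Eg * A := by ring
    rcases eq_or_lt_of_le hA0 with h0 | hpos
    · rw [← h0]; exact mul_nonneg hβ0 hEg0
    · rw [pow_two] at hsq; exact le_of_mul_le_mul_right hsq hpos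
  have hstep2 : A ≤ β ^ 2 * Gn := by
    have hsq : A ^ 2 ≤ β ^ 2 * Gn * A :=
      calc A ^ 2 ≤ (β * Eg) ^ 2 := pow_le_pow_left₀ hA0 hstep1 2
        _ = β ^ 2 * Eg ^ 2 := by ring
        _ ≤ β ^ 2 * (A * Gn) := mul_le_mul_of_nonneg_left hEg2 (by positivity)
        _ = β ^ 2 * Gn * A := by ring
    rcases eq_or_lt_of_le hA0 with h0 | hpos
    · rw [← h0]; exact mul_nonneg (sq_nonneg β) hGn0
    · rw [pow_two] at hsq; exact le_of_mul_le_mul_right hsq hpos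
  simpa only [hβ, hκ, hcn, htm] using hstep2

end Perp

/-! ## §2 The `ℓ¹ → ℓ^∞` step for `h ⊥ N(Q′(W))` -/

section PerpSup

variable [Nonempty n] {L N : ℕ} (hL : 2 ≤ L) (hN : 1 ≤ N) (j : ℕ) {W : Site d → Fin d → (Matrix n n ℂ)ˣ} {x : ℝ}
  (hWu : IsUnitaryCfg W) (hWP : IsPeriodicCfg W ((N * L ^ (j + 1) : ℕ) : ℤ)) (hx : 0 ≤ x) (hsm : LevelSmall d L j x) (hWx : SmallField W x)

include hL hN hWu hWP hx hsm hWx in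
/-- **THE `ℓ¹ → ℓ^∞` STEP FOR `h ⊥ N(Q′(W))`** (`L ≥ 2`, `N ≥ 1`, class at `W`, `M = L^{j+1}`, `P = N·M`): for skew `P`-periodic `h` with `Σ_P hsR h ν = 0`
for all `ν ∈ avgKernelGauges L N (j+1) W`, and every site `y₀`:
`‖h y₀‖ ≤ 3·card n·tentMean(d,M)⁻¹·M^{−d}·Σ_{y∈[0,P)^d}‖h y‖`.
MECHANISM: the `P`-periodic delta `δ = 1_{· ≡ y₀ (P)}·h(y₀)` minus its fix `nfixW 0 (Q′δ)` lies in `N`, so `nhs(h y₀) = ⟨h, δ⟩ = ⟨h, nfixW 0 (Q′δ)⟩`; the fix is a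
dressed bump of sup `≤ (2∕tentMean)·sup_z‖Q′δ z‖ ≤ (3∕tentMean)·M^{−d}‖h y₀‖` (§1 + `sum_block_delta_le`). [folklore] -/
theorem norm_le_of_perp {h : Site d → Matrix n n ℂ} (hhs : ∀ y, h y ∈ skewAdjoint (Matrix n n ℂ))
    (hhP : ∀ (y : Site d) (i : Fin d), h (y + ((N * L ^ (j + 1) : ℕ) : ℤ) • e i) = h y)
    (hperp : ∀ ν ∈ avgKernelGauges (d := d) (n := n) L N (j + 1) W, ∑ y ∈ periodBox (d := d) (N * L ^ (j + 1)), hsR (h y) (ν y) = 0)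
    (y₀ : Site d) :
    ‖h y₀‖ ≤ 3 * (Fintype.card n : ℝ) / tentMean d (L ^ (j + 1)) * ((((L ^ (j + 1) : ℕ) : ℝ) ^ d)⁻¹
      * ∑ y ∈ periodBox (d := d) (N * L ^ (j + 1)), ‖h y‖) := by
  classical
  have hL1 : 1 ≤ L := by omega
  have hM2 : 2 ≤ L ^ (j + 1) := le_trans hL (Nat.le_self_pow (by omega) L)
  have hM1 : 1 ≤ L ^ (j + 1) := by omega
  have hP : 1 ≤ N * L ^ (j + 1) := Nat.mul_pos (by omega) (by omega)
  have hMP : L ^ (j + 1) ≤ N * L ^ (j + 1) := Nat.le_mul_of_pos_left _ (by omega)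
  -- the periodic delta at `y₀`: skew, periodic, `⟨h, δ⟩ = nhs(h y₀)`
  have hq_mem : cmod (N * L ^ (j + 1)) y₀ ∈ periodBox (d := d) (N * L ^ (j + 1)) :=
    (mem_periodBox).2 fun κ => ⟨cmod_nonneg hP y₀ κ, cmod_lt hP y₀ κ⟩
  have hcq : cmod (N * L ^ (j + 1)) (cmod (N * L ^ (j + 1)) y₀) = cmod (N * L ^ (j + 1)) y₀ :=
    cmod_eq_of_repr (L := N * L ^ (j + 1)) (z := 0) (by simp) (fun i => (mem_periodBox.1 hq_mem i).1) (fun i => (mem_periodBox.1 hq_mem i).2)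
  have hhq : h (cmod (N * L ^ (j + 1)) y₀) = h y₀ := by
    have h1 := periodic_smul_vec hhP (cmod (N * L ^ (j + 1)) y₀) (cdiv (N * L ^ (j + 1)) y₀)
    rw [add_comm, smul_cdiv_add_cmod] at h1
    rw [← h1]
  set δ : Site d → Matrix n n ℂ := fun y => if cmod (N * L ^ (j + 1)) y = cmod (N * L ^ (j + 1)) y₀ then h y₀ else 0 with hδ
  have hδs : ∀ y, δ y ∈ skewAdjoint (Matrix n n ℂ) := by
    intro y; simp only [hδ]; split_ifs
    · exact hhs y₀
    · exact (skewAdjoint _).zero_mem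
  have hδP : ∀ (y : Site d) (i : Fin d), δ (y + ((N * L ^ (j + 1) : ℕ) : ℤ) • e i) = δ y := by
    intro y i
    have hc : cmod (N * L ^ (j + 1)) (y + ((N * L ^ (j + 1) : ℕ) : ℤ) • e i) = cmod (N * L ^ (j + 1)) y := by
      have h1 := cmod_add_period (L := N * L ^ (j + 1)) (1 : ℤ) y i
      rwa [mul_one] at h1
    simp only [hδ, hc]
  have hδq : δ (cmod (N * L ^ (j + 1)) y₀) = h y₀ := by simp [hδ, hcq]
  have hpairδ : ∑ y ∈ periodBox (d := d) (N * L ^ (j + 1)), hsR (h y) (δ y) = nhsNormSq (h y₀) := by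
    rw [Finset.sum_eq_single_of_mem _ hq_mem, hδq, hhq, hsR_self]
    intro y hy hne
    have hcy : cmod (N * L ^ (j + 1)) y = y :=
      cmod_eq_of_repr (L := N * L ^ (j + 1)) (z := 0) (by simp) (fun i => (mem_periodBox.1 hy i).1) (fun i => (mem_periodBox.1 hy i).2)
    have hδy : δ y = 0 := by simp only [hδ]; rw [if_neg (by rw [hcy]; exact hne)]
    rw [hδy, hsR_zero_right]
  -- the fix `ψ` of `δ`: `δ − ψ ∈ N`, so `⟨h, δ⟩ = ⟨h, ψ⟩`; and `‖ψ‖_∞ ≤ (2/tm)·sup_z‖Q′δ z‖ ≤ (3/tm)·M^{−d}‖h y₀‖`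
  obtain ⟨ψ, -, -, hmem, -, hψsup⟩ := exists_fix hL j hWu hWP hx hsm hWx hδs hδP
  have hident : nhsNormSq (h y₀) = ∑ y ∈ periodBox (d := d) (N * L ^ (j + 1)), hsR (h y) (ψ y) := by
    have h0 := hperp _ hmem
    simp only [hsR_sub_right, Finset.sum_sub_distrib, sub_eq_zero] at h0
    rw [← hpairδ]; exact h0
  have hMd : (0 : ℝ) < ((((L ^ (j + 1) : ℕ) : ℝ)) ^ d) := by positivity
  have htm0 : 0 < tentMean d (L ^ (j + 1)) := tentMean_pos hM2 d
  have hψsup' : ∀ y, ‖ψ y‖ ≤ 3 / tentMean d (L ^ (j + 1)) * (((((L ^ (j + 1) : ℕ) : ℝ)) ^ d)⁻¹ * ‖h y₀‖) := by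
    intro y
    refine (hψsup y).trans ?_
    have hblock := norm_bmeanIterW_le hL j hWu hx hsm hWx δ (blk (L ^ (j + 1)) y)
    have hcount : ∑ v ∈ periodBox (d := d) (L ^ (j + 1)), ‖δ ((((L ^ (j + 1) : ℕ) : ℤ)) • blk (L ^ (j + 1)) y + v)‖ ≤ ‖h y₀‖ :=
      sum_block_delta_le hM1 hMP (h y₀) (cmod (N * L ^ (j + 1)) y₀) (blk (L ^ (j + 1)) y)
    calc 2 / tentMean d (L ^ (j + 1)) * ‖bmeanIterW L (j + 1) W δ (blk (L ^ (j + 1)) y)‖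
        ≤ 2 / tentMean d (L ^ (j + 1)) * (3 / 2 * (((((L ^ (j + 1) : ℕ) : ℝ)) ^ d)⁻¹ * ‖h y₀‖)) := by
          refine mul_le_mul_of_nonneg_left (hblock.trans ?_) (by positivity)
          exact mul_le_mul_of_nonneg_left (mul_le_mul_of_nonneg_left hcount (by positivity)) (by norm_num)
      _ = 3 / tentMean d (L ^ (j + 1)) * (((((L ^ (j + 1) : ℕ) : ℝ)) ^ d)⁻¹ * ‖h y₀‖) := by ring
  -- assemble: `‖Y‖² ≤ cn·nhs(Y) ≤ cn·(3/tm)·M^{−d}·‖Y‖·S`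
  set S : ℝ := ∑ y ∈ periodBox (d := d) (N * L ^ (j + 1)), ‖h y‖ with hS
  have hcn0 : 0 ≤ (Fintype.card n : ℝ) := by positivity
  have hS0 : 0 ≤ S := Finset.sum_nonneg fun y _ => norm_nonneg _
  have hnhs : nhsNormSq (h y₀) ≤ 3 / tentMean d (L ^ (j + 1)) * (((((L ^ (j + 1) : ℕ) : ℝ)) ^ d)⁻¹ * ‖h y₀‖) * S := by
    rw [hident, hS, Finset.mul_sum]
    refine Finset.sum_le_sum fun y _ => ?_
    calc hsR (h y) (ψ y) ≤ ‖h y‖ * ‖ψ y‖ := (le_abs_self _).trans (abs_hsR_le _ _)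
      _ ≤ ‖h y‖ * (3 / tentMean d (L ^ (j + 1)) * (((((L ^ (j + 1) : ℕ) : ℝ)) ^ d)⁻¹ * ‖h y₀‖)) :=
          mul_le_mul_of_nonneg_left (hψsup' y) (norm_nonneg _)
      _ = 3 / tentMean d (L ^ (j + 1)) * (((((L ^ (j + 1) : ℕ) : ℝ)) ^ d)⁻¹ * ‖h y₀‖) * ‖h y‖ := by ring
  have hsq : ‖h y₀‖ ^ 2 ≤ (3 * (Fintype.card n : ℝ) / tentMean d (L ^ (j + 1)) * (((((L ^ (j + 1) : ℕ) : ℝ)) ^ d)⁻¹ * S)) * ‖h y₀‖ := by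
    calc ‖h y₀‖ ^ 2 ≤ (Fintype.card n : ℝ) * nhsNormSq (h y₀) := opNorm_sq_le_card_mul_nhsNormSq _
      _ ≤ (Fintype.card n : ℝ) * (3 / tentMean d (L ^ (j + 1)) * (((((L ^ (j + 1) : ℕ) : ℝ)) ^ d)⁻¹ * ‖h y₀‖) * S) :=
          mul_le_mul_of_nonneg_left hnhs hcn0
      _ = (3 * (Fintype.card n : ℝ) / tentMean d (L ^ (j + 1)) * (((((L ^ (j + 1) : ℕ) : ℝ)) ^ d)⁻¹ * S)) * ‖h y₀‖ := by ring
  rcases eq_or_lt_of_le (norm_nonneg (h y₀)) with h0 | hpos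
  · rw [← h0]; exact mul_nonneg (div_nonneg (mul_nonneg (by norm_num) hcn0) htm0.le) (mul_nonneg (inv_nonneg.mpr hMd.le) hS0)
  · rw [pow_two] at hsq; exact le_of_mul_le_mul_right hsq hpos

end PerpSup

end

end Summit.QuantumFields.BalabanUV.T4Continuum.NE3.LandauProjectionCurvedCore
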